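import Summits.QuantumFields.QCD.Theses.GapBuysCauchyRate
import Summits.QuantumFields.QCD.Theorems.GapBuysCauchyRateLadderCauchyRateStubSpeciesMultilinear

/-!
# Stub `stub_calibrationTransfer` of line `birth` for crux `GapBuysCauchyRate.LadderCauchyRate`
(item stmt-QuantumFields-17307, route route-QuantumFields-GapBuysCauchyRate, sub-problem QCD)

What is proved: the calibration transfer (W2).  For a calibrated species family `𝒞` over a
mass-independent regularisation `reg`, a mass tuple `m`, a species `s` and a step `k`: if the BARE
(`z ≡ 1`, counterterms `𝒞.shift m`) connected two-point function on the reference pair `(Θf₀, f₀)` is a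
positive real, then the CALIBRATED two-point function `⟨Φ_k^s(Θf₀) Φ_k^s(f₀)⟩` of `𝒞.scheme m` equals `1`.

How: by the landed species multilinearity (E1, `stub_speciesMultilinear`) the one-point function of
`𝒞.scheme m = reg.scheme m (𝒞.z m) (𝒞.shift m)` is `z_s(m,k)` times the bare one and the diagonal
two-point function is `z_s(m,k)²` times the bare one.  The one-point subtraction of `𝒞`
(`CalibratedSpeciesFamily.onePoint_eq_zero`) and `z_s(m,k) ≠ 0` force the bare one-point function of
`f₀` to vanish, so the bare connected two-point function is the bare full one
(`QCDScheme.connectedTwoPoint_eq_twoPoint`); hence the calibrated two-point function is `z² · B` with `B`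
the positive real of the hypothesis, again a positive real (`Complex.re_ofReal_mul`,
`Complex.im_ofReal_mul`), and the calibration identity `CalibratedSpeciesFamily.twoPoint_eq_one`
concludes.  Sources: Montvay–Münster 1994 §1.7 (1.251)–(1.253), §5.1.  Everything is proved.

Pure theorem file (no definitions): the registered stub signature, proved in tree vocabulary.
-/

noncomputable section

namespace Summit.QuantumFields.QCD.Cruxes.LadderCauchyRate.Birth

open Literature.MathematicalPhysics.AQFT Literature.Probability.LatticeModels
  Literature.MathematicalPhysics.QuantumLattice Literature.MathematicalPhysics.QuantumFieldTheory
open Summit.QuantumFields.QCD.Theses.GapBuysCauchyRate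

/-- (W2) **calibration transfer**: bare reference positivity at step `k` ⇒ the calibrated reference
two-point function is `1` at step `k` (size S; species multilinearity E1 + the one-point subtraction +
the calibration identity of `𝒞`).  Registered signature = `CalibrationTransferStmt` written out. -/
theorem stub_calibrationTransfer :
    ∀ (Nf : ℕ) (reg : QCDRegularisation Nf) (𝒞 : CalibratedSpeciesFamily reg) (m : Fin Nf → ℝ)
      (s : QCDField Nf) (k : ℕ),
      0 < ((reg.scheme m (fun _ _ => (1 : ℝ)) (𝒞.shift m)).connectedTwoPoint k s s (thetaTest 4 𝒞.f₀) 𝒞.f₀).re →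
      ((reg.scheme m (fun _ _ => (1 : ℝ)) (𝒞.shift m)).connectedTwoPoint k s s (thetaTest 4 𝒞.f₀) 𝒞.f₀).im = 0 →
        (𝒞.scheme m).twoPoint k s s (thetaTest 4 𝒞.f₀) 𝒞.f₀ = 1 := by
  intro Nf reg 𝒞 m s k hre him
  obtain ⟨h1, h2, -⟩ :=
    stub_speciesMultilinear Nf reg m (𝒞.z m) (𝒞.shift m) k s (thetaTest 4 𝒞.f₀) 𝒞.f₀
  have hz : ((𝒞.z m s k : ℝ) : ℂ) ≠ 0 := Complex.ofReal_ne_zero.2 (𝒞.z_ne_zero m s k)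
  -- the bare one-point function of `f₀` vanishes (one-point subtraction, `z ≠ 0`)
  have hf₀ : (reg.scheme m (fun _ _ => (1 : ℝ)) (𝒞.shift m)).onePoint k s 𝒞.f₀ = 0 := by
    have h0 : (reg.scheme m (𝒞.z m) (𝒞.shift m)).onePoint k s 𝒞.f₀ = 0 := 𝒞.onePoint_eq_zero m s k _
    rw [h1] at h0
    exact (mul_eq_zero.1 h0).resolve_left hz
  -- so the bare connected two-point function is the bare full one
  rw [QCDScheme.connectedTwoPoint_eq_twoPoint (Or.inr hf₀)] at hre him
  -- the calibrated two-point function is `z² ·` the bare one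
  have h2' : (𝒞.scheme m).twoPoint k s s (thetaTest 4 𝒞.f₀) 𝒞.f₀ =
      ((𝒞.z m s k : ℝ) : ℂ) ^ 2 *
        (reg.scheme m (fun _ _ => (1 : ℝ)) (𝒞.shift m)).twoPoint k s s (thetaTest 4 𝒞.f₀) 𝒞.f₀ := h2
  refine 𝒞.twoPoint_eq_one m s k ?_ ?_
  · rw [h2', ← Complex.ofReal_pow, Complex.re_ofReal_mul]
    exact mul_pos (pow_pos (𝒞.z_pos m s k) 2) hre
  · rw [h2', ← Complex.ofReal_pow, Complex.im_ofReal_mul, him, mul_zero]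

end Summit.QuantumFields.QCD.Cruxes.LadderCauchyRate.Birth

end
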